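import Summits.QuantumAdvantage.QuantumAdvantage.Theorems.CharDialTowerC
import Summits.QuantumAdvantage.QuantumAdvantage.Theorems.CharDialFieldColF
import HarnessLib

/-!
# CharDial / JLinPeel — THE DIAL TOWER, part D: the CERTIFICATE of the five-dial split, BY NAME
(route `CharDial`, item 32604; lens-6 node g18 REV6 / §11.5 writer package)

* ★ `closes_split : LowResidual5Side dialB → ResidualHigh5Side dialB → CharDial.WalkHardFJLinOdd` — the deciding theorem of the split
  (exact: `split_of_closes`).
* `spanHyp_iff_inlined`, `sparseHyp_iff_inlined`, `maskHyp_iff_inlined` (`Iff.rfl` readbacks of the hypotheses inlined in `FieldCol.fieldY_class5_eventually`).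
* ★★★★ `residualHigh5_class_inhabited (p) (5 ≤ p)`: for all large `n` SOME strategy (`FieldCol.fieldY p n α`) satisfies `JLinHyp`, is `¬ LowVar dialB`, and
  in EVERY `log₂ n`-junta presentation escapes `SpanHyp`, `SparseHyp`, `BlockHyp`, `NullHyp` AND `MaskHyp` — the hypothesis class of `ResidualHigh5Side dialB`
  is INHABITED; `residualHigh5_nonvacuous`: hence any residual bound is tested on an actual member.

What this is NOT: a proof of either residual piece.  0 sorry.
-/

set_option autoImplicit false

namespace Summit.QuantumAdvantage.AdviceFreeQNC0.JLinPeel.Tower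

open Finset

variable {n : ℕ}

section Certificate

variable {p : ℕ}

/-- ★ **the deciding theorem of the split (by name).** the two residual pieces at the node's schedule `dialB` give the CharDial crux
`WalkHardFJLinOdd`. -/
theorem closes_split (hL : LowResidual5Side dialB) (hH : ResidualHigh5Side dialB) :
    Summit.QuantumAdvantage.QuantumAdvantage.Theses.CharDial.WalkHardFJLinOdd :=
  (walkHardFJLinOdd_iff_residual5_split dialB).mpr ⟨hL, hH⟩

/-- the split is EXACT: the crux gives both pieces back (so neither piece is stronger than the crux). -/
theorem split_of_closes (hT : Summit.QuantumAdvantage.QuantumAdvantage.Theses.CharDial.WalkHardFJLinOdd) :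
    LowResidual5Side dialB ∧ ResidualHigh5Side dialB :=
  (walkHardFJLinOdd_iff_residual5_split dialB).mp hT

/-- readback (`Iff.rfl`): the rank-dial hypothesis inlined in `FieldCol.fieldY_class5_eventually` IS `SpanHyp`. -/
theorem spanHyp_iff_inlined (D : JLinPeel.JLinData p n) :
    SpanHyp D ↔ ∃ A : Fin (JLinPeel.cubeRate n) → Fin n → ZMod p,
      ∀ g, ¬ (∀ (u : Fin n → Bool) (s s' : ZMod p), D.h g u s = D.h g u s') →
        ∃ l : Fin (JLinPeel.cubeRate n) → ZMod p, D.a g = fun i => ∑ j, l j * A j i := Iff.rfl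

/-- readback (`Iff.rfl`): the sparse-dial hypothesis inlined in `FieldCol.fieldY_class5_eventually` IS `SparseHyp`. -/
theorem sparseHyp_iff_inlined (D : JLinPeel.JLinData p n) :
    SparseHyp D ↔ ∃ S : Finset (Fin n), Nat.log 2 n ≤ S.card ∧
      ∀ g, (S.filter fun i => i ∈ D.J g ∨ D.a g i ≠ 0).card ≤ Nat.sqrt S.card := Iff.rfl

/-- readback (`Iff.rfl`): the mask-dial hypothesis inlined in `FieldCol.fieldY_class5_eventually` IS `MaskHyp`. -/
theorem maskHyp_iff_inlined (D : JLinPeel.JLinData p n) :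
    MaskHyp D ↔ ∃ (ℓ m M : ℕ) (S : Fin M → ℕ) (Z : Finset (Fin n)), (m % 3 = 1 ∨ m % 3 = 2) ∧
      ((∀ k k' : Fin M, k < k' → S k + ℓ ≤ S k') ∧ (∀ k : Fin M, S k + ℓ ≤ n)) ∧
      (∀ k : Fin M, (JLinPeel.MaskDial.zblk ℓ S Z k).card = m) ∧
      2 ^ m * ((Nat.log 2 n + 1) * (Nat.log 2 n + 1) + 1) ≤ M ∧
        ∀ g (k : Fin M), ∑ i ∈ JLinPeel.MaskDial.zblk ℓ S Z k, D.a g i = 0 := Iff.rfl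

/-- ★★★★ **class(RESIDUAL-HIGH⁵) IS INHABITED.** for every prime `p ≥ 5` and all large `n`, SOME strategy (`FieldCol.fieldY p n α`, generic
field-trace columns) satisfies the JLin hypothesis of `WalkHardFJLinOdd`, lies on the HIGH side of the variation dial at schedule `dialB`, and in
EVERY `log₂ n`-junta ⊕ one-form presentation escapes the rank, sparse, block, null AND mask dials: the hypothesis class of
`ResidualHigh5Side dialB` is non-empty. -/
theorem residualHigh5_class_inhabited (p : ℕ) [hp : Fact p.Prime] (hp5 : 5 ≤ p) :
    ∃ n₁ : ℕ, ∀ n ≥ n₁, ∃ y : Fin (n + 1) → (Fin n → Bool) → Bool,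
      JLinHyp p n y ∧ ¬ LowVar dialB n y ∧
      ∀ D : JLinPeel.JLinData p n, D.strat = y → (∀ g, (D.J g).card ≤ Nat.log 2 n) →
        ¬ SpanHyp D ∧ ¬ SparseHyp D ∧ ¬ BlockHyp D ∧ ¬ NullHyp D ∧ ¬ MaskHyp D := by
  have hp3 : p % 3 = 1 ∨ p % 3 = 2 := mod3_of_prime_ge5 hp.out hp5
  obtain ⟨n₀, h⟩ := JLinPeel.FieldCol.fieldY_class5_eventually p hp5
  refine ⟨n₀, fun n hn => ?_⟩
  obtain ⟨α, -, -, hhigh, hesc⟩ := h n hn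
  refine ⟨JLinPeel.FieldCol.fieldY p n α, ?_, hhigh, fun D hD hJ => ?_⟩
  · intro g
    exact ⟨∅, by simp, (JLinPeel.FieldCol.fieldData p n α).a g, (JLinPeel.FieldCol.fieldData p n α).h g,
      fun _ _ _ _ => rfl, fun u => rfl⟩
  · obtain ⟨h1, h2, h3⟩ := hesc D hD hJ
    have h3' : ¬ MaskHyp D := (maskHyp_iff_inlined D).not.mpr h3
    exact ⟨(spanHyp_iff_inlined D).not.mpr h1, (sparseHyp_iff_inlined D).not.mpr h2,
      fun hB => h3' (maskHyp_of_blockHyp hp3 D hB), fun hN => h3' (maskHyp_of_nullHyp D hN), h3'⟩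

/-- ★ **the residual piece is tested NON-VACUOUSLY**: any purported `ResidualHigh5Side dialB` bound applies to an actual member of its hypothesis
class (for every prime `p ≥ 5`, eventually in `n`, uniformly in the residue `c`). -/
theorem residualHigh5_nonvacuous (hR : ResidualHigh5Side dialB) (p : ℕ) [Fact p.Prime] (hp5 : 5 ≤ p) :
    ∃ θ : ℝ, θ < 1 ∧ ∃ n₀ : ℕ, ∀ n ≥ n₀, ∃ y : Fin (n + 1) → (Fin n → Bool) → Bool,
      JLinHyp p n y ∧ ¬ LowVar dialB n y ∧ ∀ c : ℕ,
        ((Finset.univ.filter fun u : Fin n → Bool => ringWinU c y u = true).card : ℝ) ≤ θ * (2 : ℝ) ^ n := by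
  obtain ⟨θ, hθ, n₀, h⟩ := hR p hp5
  obtain ⟨n₁, h₁⟩ := residualHigh5_class_inhabited p hp5
  refine ⟨θ, hθ, max n₀ n₁, fun n hn => ?_⟩
  obtain ⟨y, hy, hV, hesc⟩ := h₁ n (le_trans (le_max_right _ _) hn)
  exact ⟨y, hy, hV, fun c => h n (le_trans (le_max_left _ _) hn) c y hy hV hesc⟩

end Certificate

end Summit.QuantumAdvantage.AdviceFreeQNC0.JLinPeel.Tower
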